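import Mathlib.Data.Fin.Tuple.Sort
import Summits.ValiantsHypothesis.ValiantsHypothesis.Theorems.KPlusLogSqLawTropicalPageRigidity

/-!
# Route «KPlusLogSqLaw», cruxes `WeakLifting` / `TropicalB` — LEX TOP-CLASS RIGIDITY, the `k`-term law

HONEST FRAMING.  Helper file (cell `pub-symmetroid`, seat val-sym-lift-p3 g4, 2026-08-27) toward the crux
`Summit.ValiantsHypothesis.ValiantsHypothesis.Theses.KPlusLogSqLaw.WeakLifting` (ledger item `stmt-ValiantsHypothesis-19561`; docket D2, the
`K = 4` tropical exponent fork).  It extends the three-term law of `…TropicalPageRigidity` (`classCount_eq_of_redecomp_three`) to any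
number `k` of terms; a STRUCTURAL law for dominant terms of an arbitrary design in the lex regime of one class; it proves no stub and asserts
nothing about `TropicalB`, `WeakLifting`, `Lifting`, `KPlusLogSqLaw`, `MatrixDescartes` (stmt-ValiantsHypothesis-18050) or `VP ≠ VNP`.

THE LAW (`classCount_eq_of_redecomp`).  Let the class `l⋆` have exponent `d l⋆ ≥ (k/2)·m·D` (`k/2` rounded down), `D` bounding every
other exponent, and let `t₀, …, t_{k−1}` be unique optima at strictly increasing slopes, all with the same number `c` of `l⋆`-entries (terms
of one «page»).  Then every columnwise re-decomposition `u₀, …, u_{k−1}` of the `t`'s has all `l⋆`-counts equal to `c`.  With `k` up to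
`m` (condition `d l⋆ ≥ ⌊m/2⌋·m·D`, «strongly lex») this is what makes the union support of a whole page RIGID for the top count — every
perfect matching inside it is one member of a re-decomposition of at most `m` page terms (König) — and hence GRADED (memo
`K4-PAGE-RIGIDITY-AND-CARRIES.md` §3 of this seat).

PROOF.  Re-index the `u`'s by a sorting permutation of their excesses `e_r = count_r − c` (Mathlib `Tuple.sort`; columnwise multisets are
invariant).  The excesses sum to `0`; if one is nonzero, every proper suffix sum of the sorted excesses is `≥ 1`, while the suffix sums of the
«rest» parts (`slope = d l⋆·count + rest`, `0 ≤ rest ≤ m·D`, total rest preserved) are `≥ −min(j, k−j)·m·D ≥ −(k/2)·m·D`.  Abel summation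
(`pageRigid_abel_nonneg`: increasing weights against a zero-sum sequence with nonnegative proper suffix sums give a nonnegative sum) then
yields `Σ θ_r slope u_r ≥ Σ θ_r slope t_r`, contradicting the tree's exchange lemma `sum_mul_slope_lt_of_redecomp`.
[folklore LP-duality / majorization reasoning; the packaging is the cell's]
-/

set_option linter.dupNamespace false
set_option autoImplicit false

namespace Summit.ValiantsHypothesis.ValiantsHypothesis.Theorems.LacunarySymmetroidMatrixDescartes.TropicalCensus

open Summit.ValiantsHypothesis.ValiantsHypothesis.Theorems.MatrixDescartes.Negative
open scoped BigOperators
open Finset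

section PageRigidityK

variable {m K : ℕ}

/-- **Abel summation, sign form.**  For monotone weights `θ` on `Fin (n+1)` and any integer sequence `x` whose proper suffix sums
`Σ_{r ≥ j} x_r` (`j ≠ 0`) are nonnegative, `Σ_r (θ_r − θ_0)·x_r ≥ 0`. [folklore] -/
theorem pageRigid_abel_nonneg : ∀ (n : ℕ) (θ x : Fin (n + 1) → ℤ), Monotone θ →
    (∀ j : Fin (n + 1), j ≠ 0 → 0 ≤ ∑ r, (if j ≤ r then x r else 0)) →
    0 ≤ ∑ r, (θ r - θ 0) * x r := by
  intro n
  induction n with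
  | zero =>
    intro θ x _ _
    simp
  | succ n ih =>
    intro θ x hθ htail
    rw [Fin.sum_univ_succ]
    simp only [sub_self, zero_mul, zero_add]
    -- split θ r.succ − θ 0 = (θ r.succ − θ 1) + (θ 1 − θ 0)
    have hsplit : ∑ i : Fin (n + 1), (θ i.succ - θ 0) * x i.succ
        = ∑ i : Fin (n + 1), (θ i.succ - θ (Fin.succ 0)) * x i.succ + (θ 1 - θ 0) * ∑ i : Fin (n + 1), x i.succ := by
      rw [mul_sum, ← sum_add_distrib]
      refine sum_congr rfl fun i _ => ?_
      have : (Fin.succ (0 : Fin (n + 1)) : Fin (n + 2)) = 1 := rfl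
      rw [this]; ring
    rw [hsplit]
    have h1 : 0 ≤ ∑ i : Fin (n + 1), (θ i.succ - θ (Fin.succ 0)) * x i.succ := by
      refine ih (fun i => θ i.succ) (fun i => x i.succ) (fun a b hab => hθ (Fin.succ_le_succ_iff.mpr hab)) ?_
      intro j hj
      have ht := htail j.succ (Fin.succ_ne_zero j)
      rw [Fin.sum_univ_succ] at ht
      have h0 : ¬ (j.succ ≤ (0 : Fin (n + 2))) := by
        rw [not_le]; exact Fin.succ_pos j
      simp only [h0, if_false, zero_add, Fin.succ_le_succ_iff] at ht
      exact ht
    have h2 : 0 ≤ (θ 1 - θ 0) * ∑ i : Fin (n + 1), x i.succ := by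
      refine mul_nonneg (sub_nonneg.mpr (hθ (Fin.zero_le _))) ?_
      have ht := htail 1 (ne_of_gt Fin.zero_lt_one)
      rw [Fin.sum_univ_succ] at ht
      have h0 : ¬ ((1 : Fin (n + 2)) ≤ 0) := not_le.mpr Fin.zero_lt_one
      simp only [h0, if_false, zero_add] at ht
      have h1' : ∀ i : Fin (n + 1), ((1 : Fin (n + 2)) ≤ i.succ) := fun i => Fin.succ_pos i
      simp only [h1', if_true] at ht
      exact ht
    linarith

/-- suffix sums of a bounded zero-sum sequence: if `|y_r| ≤ B` for all `r` and `Σ y = 0`, then every suffix sum over `{r ≥ j}` is at least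
`−min(j, n−j)·B`. [folklore] -/
theorem pageRigid_suffix_ge {n : ℕ} (y : Fin n → ℤ) (B : ℤ) (hB : ∀ r, -B ≤ y r ∧ y r ≤ B) (hsum : ∑ r, y r = 0)
    (j : Fin n) :
    -((min (j : ℕ) (n - j) : ℕ) : ℤ) * B ≤ ∑ r, (if j ≤ r then y r else 0) := by
  classical
  have hB0 : 0 ≤ B := by
    rcases Nat.eq_zero_or_pos n with hn | hn
    · subst hn; exact (Fin.elim0 j)
    · have := hB ⟨0, hn⟩; linarith [this.1, this.2]
  -- suffix as a filtered sum, prefix likewise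
  have hsuf : ∑ r, (if j ≤ r then y r else 0) = ∑ r ∈ univ.filter (fun r : Fin n => j ≤ r), y r := by
    rw [sum_filter]
  have hpre : ∑ r ∈ univ.filter (fun r : Fin n => j ≤ r), y r = -∑ r ∈ univ.filter (fun r : Fin n => ¬ j ≤ r), y r := by
    have := sum_filter_add_sum_filter_not univ (fun r : Fin n => j ≤ r) y
    rw [hsum] at this; linarith
  -- cardinalities
  have hcs : (univ.filter (fun r : Fin n => j ≤ r)).card = n - j := by
    have : (univ.filter (fun r : Fin n => j ≤ r)) = Finset.Ici j := by ext r; simp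
    rw [this, Fin.card_Ici]
  have hcp : (univ.filter (fun r : Fin n => ¬ j ≤ r)).card = j := by
    have : (univ.filter (fun r : Fin n => ¬ j ≤ r)) = Finset.Iio j := by ext r; simp [not_le]
    rw [this, Fin.card_Iio]
  -- two lower bounds
  have hb1 : -((n - j : ℕ) : ℤ) * B ≤ ∑ r ∈ univ.filter (fun r : Fin n => j ≤ r), y r := by
    calc -((n - j : ℕ) : ℤ) * B = ∑ _r ∈ univ.filter (fun r : Fin n => j ≤ r), (-B) := by
          rw [sum_const, hcs, nsmul_eq_mul]; ring
      _ ≤ _ := sum_le_sum fun r _ => (hB r).1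
  have hb2 : -((j : ℕ) : ℤ) * B ≤ ∑ r ∈ univ.filter (fun r : Fin n => j ≤ r), y r := by
    rw [hpre]
    have : ∑ r ∈ univ.filter (fun r : Fin n => ¬ j ≤ r), y r ≤ ((j : ℕ) : ℤ) * B := by
      calc ∑ r ∈ univ.filter (fun r : Fin n => ¬ j ≤ r), y r ≤ ∑ _r ∈ univ.filter (fun r : Fin n => ¬ j ≤ r), B :=
            sum_le_sum fun r _ => (hB r).2
        _ = ((j : ℕ) : ℤ) * B := by rw [sum_const, hcp, nsmul_eq_mul]
    linarith
  rw [hsuf]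
  rcases le_total (j : ℕ) (n - j) with h | h
  · rw [min_eq_left h]; exact hb2
  · rw [min_eq_right h]; exact hb1

/-- a monotone integer sequence with zero sum which is not identically zero has all proper suffix sums `≥ 1`. [folklore] -/
theorem pageRigid_suffix_pos {n : ℕ} (e : Fin n → ℤ) (hmono : Monotone e) (hsum : ∑ r, e r = 0) (hne : ∃ r, e r ≠ 0)
    (j : Fin n) (hj : (j : ℕ) ≠ 0) :
    1 ≤ ∑ r, (if j ≤ r then e r else 0) := by
  classical
  rw [← sum_filter]
  set S := ∑ r ∈ univ.filter (fun r : Fin n => j ≤ r), e r with hS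
  set P := ∑ r ∈ univ.filter (fun r : Fin n => ¬ j ≤ r), e r with hP
  have hPS : S + P = 0 := by
    have := sum_filter_add_sum_filter_not univ (fun r : Fin n => j ≤ r) e
    rw [hsum] at this; linarith
  -- prefix elements are ≤ e j, suffix elements are ≥ e j
  have hpre_le : P ≤ ((j : ℕ) : ℤ) * e j := by
    calc P ≤ ∑ _r ∈ univ.filter (fun r : Fin n => ¬ j ≤ r), e j :=
          sum_le_sum fun r hr => hmono (le_of_lt (not_le.mp (mem_filter.mp hr).2))
      _ = ((j : ℕ) : ℤ) * e j := by
          rw [sum_const, nsmul_eq_mul]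
          have : (univ.filter (fun r : Fin n => ¬ j ≤ r)) = Finset.Iio j := by ext r; simp [not_le]
          rw [this, Fin.card_Iio]
  have hsuf_ge : ((n - j : ℕ) : ℤ) * e j ≤ S := by
    calc ((n - j : ℕ) : ℤ) * e j = ∑ _r ∈ univ.filter (fun r : Fin n => j ≤ r), e j := by
          rw [sum_const, nsmul_eq_mul]
          have : (univ.filter (fun r : Fin n => j ≤ r)) = Finset.Ici j := by ext r; simp
          rw [this, Fin.card_Ici]
      _ ≤ S := sum_le_sum fun r hr => hmono (mem_filter.mp hr).2
  have hnj : 1 ≤ ((n - j : ℕ) : ℤ) := by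
    have : (j : ℕ) < n := j.isLt
    have : 1 ≤ n - (j : ℕ) := by omega
    exact_mod_cast this
  have hj1 : 1 ≤ ((j : ℕ) : ℤ) := by exact_mod_cast Nat.one_le_iff_ne_zero.mpr hj
  by_contra hlt
  push Not at hlt
  -- S ≤ 0
  have hS0 : S ≤ 0 := by omega
  -- then e j ≤ 0 (else S ≥ (n-j) e j ≥ 1)
  have hej : e j ≤ 0 := by
    by_contra h; push Not at h
    have : 1 ≤ ((n - j : ℕ) : ℤ) * e j := by nlinarith
    linarith
  -- prefix elements ≤ e j ≤ 0, so P ≤ 0, hence S ≥ 0, so S = 0 = P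
  have hP0 : P ≤ 0 := by nlinarith
  have hS00 : S = 0 := by linarith
  have hP00 : P = 0 := by linarith
  -- e j = 0: otherwise P ≤ j · e j < 0
  have hej0 : e j = 0 := by
    by_contra h
    have hlt' : e j < 0 := lt_of_le_of_ne hej h
    have : P ≤ ((j : ℕ) : ℤ) * e j := hpre_le
    nlinarith
  -- all suffix elements are ≥ 0 and sum to 0, all prefix elements are ≤ 0 and sum to 0: everything vanishes
  have hsuf0 : ∀ r ∈ univ.filter (fun r : Fin n => j ≤ r), e r = 0 := by
    have hnn : ∀ r ∈ univ.filter (fun r : Fin n => j ≤ r), 0 ≤ e r := by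
      intro r hr; rw [← hej0]; exact hmono (mem_filter.mp hr).2
    exact (sum_eq_zero_iff_of_nonneg hnn).mp hS00
  have hpre0 : ∀ r ∈ univ.filter (fun r : Fin n => ¬ j ≤ r), e r = 0 := by
    have hnp : ∀ r ∈ univ.filter (fun r : Fin n => ¬ j ≤ r), e r ≤ 0 := by
      intro r hr; rw [← hej0]; exact hmono (le_of_lt (not_le.mp (mem_filter.mp hr).2))
    -- a sum of nonpositive terms equal to zero
    have hnn : ∀ r ∈ univ.filter (fun r : Fin n => ¬ j ≤ r), 0 ≤ -e r := fun r hr => by linarith [hnp r hr]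
    have hs : ∑ r ∈ univ.filter (fun r : Fin n => ¬ j ≤ r), (-e r) = 0 := by rw [sum_neg_distrib]; linarith
    intro r hr
    have := (sum_eq_zero_iff_of_nonneg hnn).mp hs r hr
    linarith
  obtain ⟨r₀, hr₀⟩ := hne
  by_cases h : j ≤ r₀
  · exact hr₀ (hsuf0 r₀ (mem_filter.mpr ⟨mem_univ _, h⟩))
  · exact hr₀ (hpre0 r₀ (mem_filter.mpr ⟨mem_univ _, h⟩))

/-- **LEX TOP-CLASS RIGIDITY (`k`-term law).**  If the exponent of the class `l⋆` is at least `(k/2)·m` times every other exponent, then `k`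
dominant terms at strictly increasing slopes with the same `l⋆`-count `c` admit no columnwise re-decomposition in which some term has an
`l⋆`-count different from `c`. [folklore] -/
theorem classCount_eq_of_redecomp {k : ℕ} (d : Fin K → ℕ) (v ε : Fin m → Fin m → Fin K → ℤ)
    (θ : Fin k → ℤ) (hθ : StrictMono θ) (t u : Fin k → Equiv.Perm (Fin m) × (Fin m → Fin K))
    (hdom : ∀ r, IsDominant d v ε (θ r) (t r))
    (hcol : ∀ i : Fin m, (univ : Finset (Fin k)).val.map (fun r => ((u r).1 i, (u r).2 i)) =
      (univ : Finset (Fin k)).val.map (fun r => ((t r).1 i, (t r).2 i)))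
    (lstar : Fin K) (D : ℕ) (hD : ∀ l, l ≠ lstar → d l ≤ D) (hlex : (k / 2) * m * D ≤ d lstar)
    (c : ℕ) (hc : ∀ r, (univ.filter fun i => (t r).2 i = lstar).card = c) :
    ∀ r, (univ.filter fun i => (u r).2 i = lstar).card = c := by
  classical
  rcases Nat.eq_zero_or_pos k with hk | hk
  · subst hk; intro r; exact Fin.elim0 r
  -- write k = n + 1
  obtain ⟨n, rfl⟩ : ∃ n, k = n + 1 := ⟨k - 1, by omega⟩
  set cnt : (Equiv.Perm (Fin m) × (Fin m → Fin K)) → ℤ := fun p => ((univ.filter fun i => p.2 i = lstar).card : ℤ)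
    with hcnt
  by_contra hne
  push Not at hne
  obtain ⟨r₀, hr₀⟩ := hne
  -- sort the u's by their counts
  let f : Fin (n + 1) → ℤ := fun r => cnt (u r)
  let π : Equiv.Perm (Fin (n + 1)) := Tuple.sort f
  have hmono : Monotone (f ∘ π) := Tuple.monotone_sort f
  let u' : Fin (n + 1) → Equiv.Perm (Fin m) × (Fin m → Fin K) := fun r => u (π r)
  have hcol' : ∀ i : Fin m, (univ : Finset (Fin (n + 1))).val.map (fun r => ((u' r).1 i, (u' r).2 i)) =
      (univ : Finset (Fin (n + 1))).val.map (fun r => ((t r).1 i, (t r).2 i)) := by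
    intro i; rw [← hcol i]; exact pageRigid_colMultiset_comp_equiv u π i
  -- excesses
  let e : Fin (n + 1) → ℤ := fun r => cnt (u' r) - c
  have hemono : Monotone e := fun a b hab => by
    show cnt (u (π a)) - c ≤ cnt (u (π b)) - c
    have := hmono hab; simp only [Function.comp, f] at this; linarith
  have htot : ∑ r, cnt (u r) = ∑ r, cnt (t r) := by
    simp only [hcnt, pageRigid_count_eq_sum_ite]
    exact pageRigid_sum_colfun_eq_of_redecomp t u hcol (fun _ l => if l = lstar then 1 else 0)
  have htot' : ∑ r, cnt (u' r) = ∑ r, cnt (u r) := Equiv.sum_comp π (fun r => cnt (u r))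
  have hesum : ∑ r, e r = 0 := by
    show ∑ r, (cnt (u' r) - (c : ℤ)) = 0
    rw [sum_sub_distrib, htot', htot]
    simp [hcnt, hc]
  have hene : ∃ r, e r ≠ 0 := by
    refine ⟨π.symm r₀, ?_⟩
    show cnt (u (π (π.symm r₀))) - (c : ℤ) ≠ 0
    rw [Equiv.apply_symm_apply]
    intro h
    apply hr₀
    have : cnt (u r₀) = c := by linarith
    simp only [hcnt] at this; exact_mod_cast this
  have hune : u' ≠ t := by
    intro h
    obtain ⟨r, hr⟩ := hene
    apply hr
    show cnt (u' r) - (c : ℤ) = 0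
    rw [h]; simp [hcnt, hc]
  -- the exchange lemma
  have hlt := sum_mul_slope_lt_of_redecomp d v ε θ t u' hdom hcol' hune
  -- slopes split as top + rest
  set E : ℤ := (d lstar : ℤ) with hE
  set rest : (Equiv.Perm (Fin m) × (Fin m → Fin K)) → ℤ :=
    fun p => ∑ i ∈ univ.filter (fun i => ¬ p.2 i = lstar), (d (p.2 i) : ℤ) with hrest
  have hsl : ∀ p : Equiv.Perm (Fin m) × (Fin m → Fin K), slope d p = E * cnt p + rest p :=
    fun p => pageRigid_slope_eq_count_add_rest d lstar p
  have hr0 : ∀ p : Equiv.Perm (Fin m) × (Fin m → Fin K), 0 ≤ rest p := fun p => pageRigid_rest_nonneg d lstar p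
  have hr1 : ∀ p : Equiv.Perm (Fin m) × (Fin m → Fin K), rest p ≤ (m : ℤ) * D :=
    fun p => pageRigid_rest_le d lstar D hD p
  -- the difference sequence
  let x : Fin (n + 1) → ℤ := fun r => slope d (u' r) - slope d (t r)
  let y : Fin (n + 1) → ℤ := fun r => rest (u' r) - rest (t r)
  have hxy : ∀ r, x r = E * e r + y r := by
    intro r
    show slope d (u' r) - slope d (t r) = E * (cnt (u' r) - c) + (rest (u' r) - rest (t r))
    rw [hsl, hsl]
    have : cnt (t r) = c := by simp only [hcnt, hc]
    rw [this]; ring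
  have hslopetot : ∑ r, slope d (u' r) = ∑ r, slope d (t r) := by
    unfold slope
    exact pageRigid_sum_colfun_eq_of_redecomp t u' hcol' (fun _ l => (d l : ℤ))
  have hxsum : ∑ r, x r = 0 := by
    show ∑ r, (slope d (u' r) - slope d (t r)) = 0
    rw [sum_sub_distrib, hslopetot]; ring
  have hysum : ∑ r, y r = 0 := by
    have : ∑ r, x r = E * ∑ r, e r + ∑ r, y r := by
      rw [mul_sum, ← sum_add_distrib]; exact sum_congr rfl fun r _ => hxy r
    rw [hxsum, hesum, mul_zero, zero_add] at this
    exact this.symm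
  have hyB : ∀ r, -((m : ℤ) * D) ≤ y r ∧ y r ≤ (m : ℤ) * D := by
    intro r
    constructor
    · show -((m : ℤ) * D) ≤ rest (u' r) - rest (t r); linarith [hr0 (u' r), hr1 (t r)]
    · show rest (u' r) - rest (t r) ≤ (m : ℤ) * D; linarith [hr1 (u' r), hr0 (t r)]
  -- suffix sums of x are nonnegative
  have hElex : ((((n + 1) / 2 : ℕ) : ℤ)) * ((m : ℤ) * D) ≤ E := by
    rw [hE]; exact_mod_cast (by simpa [mul_assoc] using hlex)
  have htail : ∀ j : Fin (n + 1), j ≠ 0 → 0 ≤ ∑ r, (if j ≤ r then x r else 0) := by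
    intro j hj
    have hj' : (j : ℕ) ≠ 0 := fun h => hj (Fin.ext h)
    have h1 := pageRigid_suffix_pos e hemono hesum hene j hj'
    have h2 := pageRigid_suffix_ge y ((m : ℤ) * D) hyB hysum j
    have hsplit : ∑ r, (if j ≤ r then x r else 0)
        = E * ∑ r, (if j ≤ r then e r else 0) + ∑ r, (if j ≤ r then y r else 0) := by
      rw [mul_sum, ← sum_add_distrib]
      refine sum_congr rfl fun r _ => ?_
      split_ifs <;> simp [hxy]
    rw [hsplit]
    have hmin : ((min (j : ℕ) (n + 1 - j) : ℕ) : ℤ) ≤ (((n + 1) / 2 : ℕ) : ℤ) := by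
      have : min (j : ℕ) (n + 1 - (j : ℕ)) ≤ (n + 1) / 2 := by
        have hjlt : (j : ℕ) < n + 1 := j.isLt
        rcases le_total (j : ℕ) (n + 1 - j) with h | h
        · rw [min_eq_left h]; omega
        · rw [min_eq_right h]; omega
      exact_mod_cast this
    have hE0 : 0 ≤ E := by rw [hE]; positivity
    have hmD : 0 ≤ (m : ℤ) * D := by positivity
    nlinarith
  -- Abel: Σ (θ r − θ 0) x r ≥ 0, i.e. Σ θ r x r ≥ 0, contradicting the exchange lemma
  have habel := pageRigid_abel_nonneg n θ x hθ.monotone htail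
  have hzero : ∑ r, (θ r - θ 0) * x r = ∑ r, θ r * x r := by
    have : ∑ r, (θ r - θ 0) * x r = ∑ r, θ r * x r - θ 0 * ∑ r, x r := by
      rw [mul_sum, ← sum_sub_distrib]; exact sum_congr rfl fun r _ => by ring
    rw [this, hxsum, mul_zero, sub_zero]
  have hsum_x : ∑ r, θ r * x r = ∑ r, θ r * slope d (u' r) - ∑ r, θ r * slope d (t r) := by
    rw [← sum_sub_distrib]; exact sum_congr rfl fun r _ => by show θ r * (slope d (u' r) - slope d (t r)) = _; ring
  rw [hzero, hsum_x] at habel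
  linarith

end PageRigidityK

end Summit.ValiantsHypothesis.ValiantsHypothesis.Theorems.LacunarySymmetroidMatrixDescartes.TropicalCensus
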